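import Literature.NumberTheory.GaloisRepresentations.ContinuousCohomologyDivisibleSequence
import Literature.NumberTheory.GaloisRepresentations.ContinuousCohomologyMultiplicationSequences
import Literature.NumberTheory.GaloisRepresentations.ContinuousCohomologyAdditiveTransport
import Literature.NumberTheory.GaloisCohomology.PoitouTateRestrictedRamification
import HarnessLib

/-!
# T-42-mult in the kernel, LI — P49-KERNEL (9): the LEO REDUCTION — from `H²(Γ, 𝒟)[θ]` to the finite
# pieces `H²(Γ, 𝒟[θ][p^k])`, and the finite-level exponent bookkeeping `Ш¹ ↝ Ш² ↝ H²(G_S, M)`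

Cell `bsd-2adic` (run/shared/lean/pub/bsd-2adic/), seat `bsd-2adic-t42` GEN 19 (pen RC-337; memo
`t42/DESIGN-T42-ADDENDUM-22` §A22.3, files (E1)/(Z) glue). HONEST FRAMING: research route; THEOREMS ONLY (no
`def`, no named fact, no instance, no `sorry`); nothing booked; BSD is not proved by any of this. PARTITION:
X5@2 multiplicative GV-transport rows (K4ᵐ B1·O1; input LEO of `P49Kernel.prop49_of_LEO`, p671196) × all p —
reduces-the-named-input-of; bears_on K4 19922 / 19923 (`--supports stmt-BirchSwinnertonDyer-19923`).

## What (generic; Greenberg LNM 1716 pp. 116–118 in exponent form)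

For a compact group `Γ`, a discrete `Λ`-module `𝒟` with a continuous `Λ`-linear `Γ`-action `ρ`, `θ ∈ Λ`
acting onto `𝒟`, and a natural number `n`:
* `nsmul_torsionBy_H_eq_zero_of_subrepresentation` — if `n` kills `H^q(Γ, 𝒟[θ])` then `n` kills
  `H^q(Γ, 𝒟)[θ]` (sequence (5): `H^q(Γ, 𝒟[θ]) ↠ H^q(Γ, 𝒟)[θ]`, tree `range_Hmap_torsionBy_eq_torsionBy_H`);
* `nsmul_H_eq_zero_of_forall_pow` — if `𝒟` is `p`-primary and `p^k`-divisible for all `k`, and `n` kills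
  every `H^q(Γ, 𝒟[p^k])`, then `n` kills `H^q(Γ, 𝒟)` (every class is `p^k`-torsion for some `k` —
  `exists_forall_mem_pow_smul_continuousCohomology_eq_zero` — and lifts to `H^q(Γ, 𝒟[p^k])`);
* `nsmul_torsionBy_H_eq_zero_of_forall_pow` — the two combined for `𝒟[θ]`: if `n` kills every
  `H^q(Γ, 𝒟[θ][p^k])` then `n` kills `H^q(Γ, 𝒟)[θ]`;
* `nsmul_H_eq_zero_of_continuousAddEquiv` — `n` kills `H^q(Γ, M₁)` iff it kills `H^q(Γ, M₂)` for modules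
  identified by an equivariant continuous additive equivalence (any two coefficient rings; tree
  `ContinuousRep.HAddEquivOfContinuousAddEquiv`).
Finite-level bookkeeping over a number field `K` (`PoitouTateRestrictedRamification` currency):
* `nsmul_shaRestricted_two_eq_zero_of_pairing` — a bi-additive `b : Ш²_S(K, M) × Ш¹_S(K, M^D) → ℤ/n` with
  injective left adjoint transfers «`a` kills `Ш¹_S(K, M^D)`» to «`a` kills `Ш²_S(K, M)`» (the shape of
  Harari Thm. 17.13 (b) = `poitouTate_shaRestricted_tateDual`);
* `nsmul_restrictedCohomology_two_eq_zero` — if `a` kills `Ш²_S(K, M)` and `b` kills `H²(K_v, M)` for the finite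
  `v ∈ S` and the infinite `v`, then `a·b` kills `H²(G_S, M)`.

References: [GreenbergLNM1716] proof of Prop. 4.9 pp. 116–118; [Greenberg2006] §3 B sequence (5) p. 360;
[Harari2020] Thm. 17.13 (b), §17.3.
-/

set_option autoImplicit false
set_option linter.dupNamespace false

noncomputable section

open scoped Classical

universe u

namespace Summit.BirchSwinnertonDyer.BirchSwinnertonDyer.Theorems.P49Kernel

open NumberField IsDedekindDomain Field
  Literature.NumberTheory.GaloisRepresentations Literature.NumberTheory.GaloisCohomology
  Literature.NumberTheory.IwasawaTheory.Greenberg2016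

/-! ## §1. From `H^q(Γ, 𝒟[θ])` to `H^q(Γ, 𝒟)[θ]`, and exhaustion by the `p^k`-torsion pieces -/

section Reduction

variable {Λ : Type u} [CommRing Λ] [TopologicalSpace Λ]
  {Γ : Type u} [Group Γ] [TopologicalSpace Γ] [IsTopologicalGroup Γ] [CompactSpace Γ]
  {D : Type u} [AddCommGroup D] [Module Λ D] [TopologicalSpace D] [DiscreteTopology D] [ContinuousSMul Λ D]
  (ρ : ContinuousRep Γ Λ D)

/-- **If `n` kills `H^q(Γ, 𝒟[θ])` then `n` kills `H^q(Γ, 𝒟)[θ]`** for `θ` acting onto `𝒟`: the map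
`H^q(Γ, 𝒟[θ]) → H^q(Γ, 𝒟)` has image exactly `H^q(Γ, 𝒟)[θ]` (Greenberg 2006 sequence (5), tree
`range_Hmap_torsionBy_eq_torsionBy_H`). LNM 1716 p. 117: «`b` is surjective». [cite: GreenbergLNM1716, proof of Prop. 4.9, pp. 116–117]
[cite: Greenberg2006, §3 B (5), p. 360 L25–33] -/
theorem nsmul_torsionBy_H_eq_zero_of_subrepresentation (θ : Λ) (hθ : Function.Surjective fun d : D ↦ θ • d)
    (q : ℕ) {n : ℕ}
    (h : ∀ y : (ρ.subrepresentation (Submodule.torsionBy Λ D θ) (ρ.torsionBy_smul_le_comap θ)).H q, n • y = 0) :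
    ∀ x : ρ.H q, θ • x = 0 → n • x = 0 := by
  intro x hx
  have hx' : x ∈ Submodule.torsionBy Λ (ρ.H q) θ := (Submodule.mem_torsionBy_iff θ x).mpr hx
  rw [← ρ.range_Hmap_torsionBy_eq_torsionBy_H θ hθ q] at hx'
  obtain ⟨y, rfl⟩ := hx'
  rw [← map_nsmul, h y, map_zero]

/-- **Exhaustion by the `p^k`-torsion pieces.** If every element of `𝒟` is killed by a power of `p`, `p^k`
acts onto `𝒟` for every `k`, and `n` kills `H^q(Γ, 𝒟[p^k])` for every `k`, then `n` kills `H^q(Γ, 𝒟)`: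
a class `x` is killed by some `p^k` (compact `Γ`, discrete `𝒟`:
`exists_forall_mem_pow_smul_continuousCohomology_eq_zero`), hence lies in `H^q(Γ, 𝒟)[p^k]`, the image of
`H^q(Γ, 𝒟[p^k])`. (Greenberg LNM 1716 p. 117: Lemma 4.11's device `0 → M[2^m] → M → M → 0`.)
[cite: GreenbergLNM1716, proof of Lemma 4.11, pp. 117–118] [cite: Greenberg2006, §3 B (5), p. 360 L25–33] -/
theorem nsmul_H_eq_zero_of_forall_pow (p : ℕ) (hprim : ∀ d : D, ∃ k : ℕ, ((p : Λ) ^ k) • d = 0)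
    (hdiv : ∀ k : ℕ, Function.Surjective fun d : D ↦ ((p : Λ) ^ k) • d) (q : ℕ) {n : ℕ}
    (h : ∀ (k : ℕ) (y : (ρ.subrepresentation (Submodule.torsionBy Λ D ((p : Λ) ^ k))
      (ρ.torsionBy_smul_le_comap ((p : Λ) ^ k))).H q), n • y = 0) :
    ∀ x : ρ.H q, n • x = 0 := by
  intro x
  -- `x` is killed by some `p^k`
  have hD : ∀ d : D, ∃ k : ℕ, ∀ r ∈ (Ideal.span {(p : Λ)}) ^ k, r • d = 0 := by
    intro d
    obtain ⟨k, hk⟩ := hprim d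
    refine ⟨k, fun r hr ↦ ?_⟩
    rw [Ideal.span_singleton_pow, Ideal.mem_span_singleton] at hr
    obtain ⟨a, rfl⟩ := hr
    rw [mul_comm, mul_smul, hk, smul_zero]
  obtain ⟨k, hk⟩ := ρ.exists_forall_mem_pow_smul_continuousCohomology_eq_zero (Ideal.span {(p : Λ)}) hD q x
  have hx : ((p : Λ) ^ k) • x = 0 :=
    hk _ (by rw [Ideal.span_singleton_pow]; exact Ideal.mem_span_singleton_self _)
  exact nsmul_torsionBy_H_eq_zero_of_subrepresentation ρ ((p : Λ) ^ k) (hdiv k) q (h k) x hx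

/-- **The two reductions combined for the twist piece `𝒟[θ]`.** If `θ` acts onto `𝒟`, `𝒟[θ]` is `p`-primary
and `p^k`-divisible for every `k`, and `n` kills `H^q(Γ, 𝒟[θ][p^k])` for every `k`, then `n` kills
`H^q(Γ, 𝒟)[θ]`. This is the exponent form of Greenberg's chain
`H²(F_Σ/F, 𝒜[θ_s]) ↠ H²(F_Σ/F, 𝒜)[θ_s]` with `𝒜[θ_s] = A_{−s} = ⋃_k A_{−s}[p^k]`.
[cite: GreenbergLNM1716, proof of Prop. 4.9, pp. 116–118] -/
theorem nsmul_torsionBy_H_eq_zero_of_forall_pow (θ : Λ) (hθ : Function.Surjective fun d : D ↦ θ • d)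
    (p : ℕ) (hprim : ∀ d : Submodule.torsionBy Λ D θ, ∃ k : ℕ, ((p : Λ) ^ k) • d = 0)
    (hdiv : ∀ k : ℕ, Function.Surjective fun d : Submodule.torsionBy Λ D θ ↦ ((p : Λ) ^ k) • d)
    (q : ℕ) {n : ℕ}
    (h : ∀ (k : ℕ) (y : ((ρ.subrepresentation (Submodule.torsionBy Λ D θ) (ρ.torsionBy_smul_le_comap θ)).subrepresentation
      (Submodule.torsionBy Λ (Submodule.torsionBy Λ D θ) ((p : Λ) ^ k))
      ((ρ.subrepresentation (Submodule.torsionBy Λ D θ) (ρ.torsionBy_smul_le_comap θ)).torsionBy_smul_le_comap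
        ((p : Λ) ^ k))).H q), n • y = 0) :
    ∀ x : ρ.H q, θ • x = 0 → n • x = 0 :=
  nsmul_torsionBy_H_eq_zero_of_subrepresentation ρ θ hθ q
    (nsmul_H_eq_zero_of_forall_pow
      (ρ.subrepresentation (Submodule.torsionBy Λ D θ) (ρ.torsionBy_smul_le_comap θ)) p hprim hdiv q h)

end Reduction

/-! ## §2. Transport of exponents along equivariant additive equivalences -/

section Transport

variable {Γ : Type u} [Group Γ] [TopologicalSpace Γ] [IsTopologicalGroup Γ]
  {A₁ : Type u} [CommRing A₁] [TopologicalSpace A₁]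
  {A₂ : Type u} [CommRing A₂] [TopologicalSpace A₂]
  {M₁ : Type u} [AddCommGroup M₁] [Module A₁ M₁] [TopologicalSpace M₁] [IsTopologicalAddGroup M₁]
  [ContinuousSMul A₁ M₁]
  {M₂ : Type u} [AddCommGroup M₂] [Module A₂ M₂] [TopologicalSpace M₂] [IsTopologicalAddGroup M₂]
  [ContinuousSMul A₂ M₂]

/-- **`n` kills `H^q(Γ, M₁)` as soon as it kills `H^q(Γ, M₂)`**, for modules identified by an equivariant
continuous additive equivalence `η : M₁ ≃ M₂` over possibly different coefficient rings (tree
`ContinuousRep.HAddEquivOfContinuousAddEquiv`). Used to move between the `Λ`-module `𝒜[θ_u][p^k]` and the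
`ℤ`-module `E[p^k](χ_u)`. [cite: Brown1982CohomologyGroups, III.1 Example 3] -/
theorem nsmul_H_eq_zero_of_continuousAddEquiv (ρ₁ : ContinuousRep Γ A₁ M₁) (ρ₂ : ContinuousRep Γ A₂ M₂)
    (η : M₁ ≃ₜ+ M₂) (hη : ∀ (g : Γ) (x : M₁), η (ρ₁ g x) = ρ₂ g (η x)) (q : ℕ) {n : ℕ}
    (h : ∀ y : ρ₂.H q, n • y = 0) : ∀ x : ρ₁.H q, n • x = 0 := by
  intro x
  apply (ContinuousRep.HAddEquivOfContinuousAddEquiv ρ₁ ρ₂ η hη q).injective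
  rw [map_nsmul, h, map_zero]

end Transport

/-! ## §3. Finite level: `Ш¹_S(K, M^D) ↝ Ш²_S(K, M) ↝ H²(G_S, M)` in exponent form -/

section Finite

variable {K : Type} [Field K] [NumberField K] {M : Type} [AddCommGroup M] [TopologicalSpace M]
  [DiscreteTopology M]

/-- **Duality transfers exponents**: for a bi-additive pairing `b : X × Y → C` whose left adjoint is injective,
if `a` kills `Y` then `a` kills `X` (`b(a·x)(y) = b(x)(a·y) = 0`). The shape of Harari Thm. 17.13 (b)
(`poitouTate_shaRestricted_tateDual`: `X = Ш²_S(K, M)`, `Y = Ш¹_S(K, M^D)`, `C = ℤ/n`).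
[cite: Harari2020, Thm. 17.13 (b) (p. 294)] -/
theorem nsmul_eq_zero_of_pairing_injective {X Y C : Type*} [AddCommGroup X] [AddCommGroup Y]
    [AddCommGroup C] (b : X →+ Y →+ C) (hb : Function.Injective b) {a : ℕ} (hY : ∀ y : Y, a • y = 0)
    (x : X) : a • x = 0 := by
  apply hb
  ext y
  rw [map_nsmul, map_zero, AddMonoidHom.zero_apply, AddMonoidHom.nsmul_apply, ← map_nsmul, hY, map_zero]

/-- **`Ш²_S(K, M)` is killed by whatever kills `Ш¹_S(K, M^D)`**, granted a pairing as in
`poitouTate_shaRestricted_tateDual`. [cite: Harari2020, Thm. 17.13 (b) (p. 294)] [cite: MilneADT2006, Ch. I, Thm. 4.10 (a)] -/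
theorem nsmul_shaRestricted_two_eq_zero_of_pairing [Finite M] (ρ : DiscreteGaloisModule K M)
    (S : Set (HeightOneSpectrum (𝓞 K))) (m : ℕ)
    (b : ρ.shaRestricted S 2 →+ (ρ.tateDual m).shaRestricted S 1 →+ ZMod m) (hb : Function.Injective b)
    {a : ℕ} (h1 : ∀ y : (ρ.tateDual m).shaRestricted S 1, a • y = 0) :
    ∀ x : ρ.shaRestricted S 2, a • x = 0 :=
  nsmul_eq_zero_of_pairing_injective b hb h1

/-- **`H²(G_S, M)` is killed by `a·b`** if `a` kills `Ш²_S(K, M)` and `b` kills the local groups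
`H²(K_v, M)` at the finite places `v ∈ S` and at the infinite places: `b·x` is locally trivial everywhere
on `S ∪ Ω_∞`, i.e. lies in `Ш²_S(K, M)`. (Harari §17.3: `Ш²_S = Ker[β² : H²(G_S, M) → P²_S(k, M)]`.)
[cite: Harari2020, §17.3 (p. 294) and Lemma 17.8] -/
theorem nsmul_restrictedCohomology_two_eq_zero (ρ : DiscreteGaloisModule K M)
    (S : Set (HeightOneSpectrum (𝓞 K))) {a b : ℕ}
    (hsha : ∀ x : ρ.shaRestricted S 2, a • x = 0)
    (hfin : ∀ v ∈ S, ∀ y : galoisCohomology (ρ.toLocal (Sum.inr v)) 2, b • y = 0)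
    (hinf : ∀ (w : InfinitePlace K) (y : galoisCohomology (ρ.toLocal (Sum.inl w)) 2), b • y = 0) :
    ∀ x : ρ.restrictedCohomology S 2, (a * b) • x = 0 := by
  intro x
  have hmem : b • x ∈ ρ.shaRestricted S 2 := by
    rw [DiscreteGaloisModule.mem_shaRestricted_iff]
    exact ⟨fun w ↦ by rw [map_nsmul, hinf w], fun v hv ↦ by rw [map_nsmul, hfin v hv]⟩
  have h := hsha ⟨b • x, hmem⟩
  rw [← Subtype.coe_inj, AddSubgroup.coe_nsmul, AddSubgroup.coe_zero] at h
  rw [mul_comm, mul_nsmul]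
  exact h

end Finite

end Summit.BirchSwinnertonDyer.BirchSwinnertonDyer.Theorems.P49Kernel

end
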